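import Literature.NumberTheory.Automorphic.BorelGoodPlacePushPull
import Literature.NumberTheory.Automorphic.PushPullHeckeEigenvalues
import HarnessLib

/-!
# Hecke eigenvalues on the Borel stratum factor: `a_{w,1} = N(w) ζ_w μ_w⁻¹ + μ_w`, `a_{w,2} = ζ_w`

Topic `NumberTheory/Automorphic`; namespace `Literature.NumberTheory.Automorphic`, grouping
sub-namespaces `TwistedQuotient` (two generic commutation lemmas) and `BigHeckeGLn`.

We assemble `BorelGoodPlaceModel`/`Hecke`/`PushPull` with the linear algebra of
`PushPullHeckeEigenvalues`.  Let `K` be a number field, `S` a FINITE set of finite places,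
`U ≤ GL₂(𝔸_K^∞)` a level unramified outside `S` with `H_S · U = GL₂(𝔸_K^∞)`, `Γ` a group mapping
to `H_S` (e.g. the `K`-points of the Borel) and `ρ` a representation of `Γ` on a vector space over
an algebraically closed field `E` of characteristic `0`.  If the Borel-model cohomology
`H^q(Γ, Fun(H_S ⧸ (U ∩ H_S), V))` is finite-dimensional, then for every NON-ZERO class
`x ∈ H^q(Γ, Fun(GL₂(𝔸_K^∞) ⧸ U, V))` which is, for almost all `w`, an eigenvector of `T_{w,1}` and
`T_{w,2}` with eigenvalues `a_{w,1}`, `a_{w,2}`: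

`exists_eigenvalue_factorisation` — there are `μ_w ≠ 0`, `ζ_w ∈ E` with, for almost all `w`,
**`a_{w,1} = N(w) ζ_w μ_w⁻¹ + μ_w` and `a_{w,2} = ζ_w`**, i.e. the Hecke polynomial
`X² − a_{w,1} X + N(w) a_{w,2}` has the roots `μ_w` and `N(w) ζ_w μ_w⁻¹`; moreover `μ_w`, `ζ_w` are
the eigenvalues on a simultaneous eigenvector `y₀ ≠ 0` of the Borel operators
`T^B_{diag(1,ϖ_w)}` and `T_{ϖ_w · 1}` in the Borel model (all `w ∉ S`).

This is the eigenvalue computation of [Harder1987, §2] (there phrased through the induced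
representations `Ind_B^G χ`): `μ_w = χ₂(ϖ_w)`, `ζ_w = χ₁χ₂(ϖ_w)` for the pair of characters
`(χ₁, χ₂)` of the torus through which the Borel Hecke algebra acts on the eigenline.

## References

* G. Harder, *Eisenstein cohomology of arithmetic groups. The case GL₂*, Invent. Math. 89 (1987), §2
  [Harder1987].
-/

noncomputable section

open scoped NumberField
open IsDedekindDomain CategoryTheory

namespace Literature.NumberTheory.Automorphic

/-! ### Commuting Hecke operators on twisted cohomology -/

namespace TwistedQuotient

section Comm

universe u

variable {k : Type u} [CommRing k] {Γ 𝒢 : Type u} [Group Γ] [Group 𝒢]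
variable (ι : Γ →* 𝒢) (L : Subgroup 𝒢) {V : Type u} [AddCommGroup V] [Module k V]
  (ρ : Representation k Γ V)

/-- Commuting Hecke operators on `Fun(𝒢 ⧸ L, V)` give commuting Hecke operators on twisted
cohomology. [folklore] -/
theorem heckeEnd_comm_of_heckeFun_comm {g g' : 𝒢}
    (hc : ArithmeticQuotient.heckeFun k L g V ∘ₗ ArithmeticQuotient.heckeFun k L g' V =
      ArithmeticQuotient.heckeFun k L g' V ∘ₗ ArithmeticQuotient.heckeFun k L g V)
    (q : ℕ) (x : cohomology ι L ρ q) :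
    heckeEnd ι L ρ g q (heckeEnd ι L ρ g' q x) = heckeEnd ι L ρ g' q (heckeEnd ι L ρ g q x) := by
  have hrep : heckeRepHom ι L ρ g' ≫ heckeRepHom ι L ρ g = heckeRepHom ι L ρ g ≫ heckeRepHom ι L ρ g' :=
    Rep.hom_ext (Representation.IntertwiningMap.ext hc)
  change (heckeOperator ι L ρ g' q ≫ heckeOperator ι L ρ g q).hom x =
    (heckeOperator ι L ρ g q ≫ heckeOperator ι L ρ g' q).hom x
  rw [heckeOperator, heckeOperator, ← groupCohomology.map_id_comp, hrep, groupCohomology.map_id_comp]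

variable {G₁ G₂ : Type*} [Group G₁] [Group G₂] {K₁ : Subgroup G₁} {K₂ : Subgroup G₂}
  {ι₁ : G₁ →* 𝒢} {π₁ : 𝒢 →* G₁} {ι₂ : G₂ →* 𝒢} {π₂ : 𝒢 →* G₂}

/-- **Hecke operators at two orthogonal unramified places commute** on twisted cohomology.
[folklore] -/
theorem heckeEnd_comm_of_orthogonal (h₁ : ArithmeticQuotient.IsUnramifiedLevel K₁ ι₁ π₁ L)
    (h₂ : ArithmeticQuotient.IsUnramifiedLevel K₂ ι₂ π₂ L) (horth : ∀ y : G₁, π₂ (ι₁ y) = 1)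
    (a : G₁) (b : G₂) (q : ℕ) (x : cohomology ι L ρ q) :
    heckeEnd ι L ρ (ι₁ a) q (heckeEnd ι L ρ (ι₂ b) q x) =
      heckeEnd ι L ρ (ι₂ b) q (heckeEnd ι L ρ (ι₁ a) q x) :=
  heckeEnd_comm_of_heckeFun_comm ι L ρ
    (ArithmeticQuotient.heckeFun_comm_of_orthogonal k V h₁ h₂ horth a b) q x

end Comm

end TwistedQuotient

namespace BigHeckeGLn

variable {K : Type} [Field K] [NumberField K]

/-! ### Orthogonality of the Borel local embeddings at two places -/

/-- `(ι_w y)_{w'} = 1` in the Borel model, for `w ≠ w'`. [folklore] -/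
theorem toBorelLocal_ofBorelLocal_of_ne {n : ℕ} {S : Set (HeightOneSpectrum (𝓞 K))}
    {w w' : HeightOneSpectrum (𝓞 K)} (hw' : w' ∉ S) (hne : w' ≠ w)
    (y : standardParabolicGL (w.adicCompletion K) (id : Fin n → Fin n)) :
    toBorelLocal S w' hw' (ofBorelLocal (n := n) S w y) = 1 :=
  Subtype.ext (by rw [coe_toBorelLocal, coe_ofBorelLocal, localComponent_ofLocal_of_ne hne]; rfl)

/-! ### The factorisation -/

section Factorisation

variable (S : Set (HeightOneSpectrum (𝓞 K))) (U : Subgroup (FiniteAdelicGL 2 K))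
  {E : Type} [Field E] {Γ : Type} [Group Γ]
  (ι : Γ →* FiniteAdelicGL 2 K) (hι : ∀ γ, ι γ ∈ borelAwayFrom (n := 2) S)
  {V : Type} [AddCommGroup V] [Module E V] (ρ : Representation E Γ V) (q : ℕ)

/-- The cohomology of the Borel model `H^q(Γ, Fun(H_S ⧸ (U ∩ H_S), V))`. [folklore] -/
abbrev borelModelCohomology : Type :=
  TwistedQuotient.cohomology (ι.codRestrict _ hι) (U.subgroupOf (borelAwayFrom S)) ρ q

/-- The Hecke operator of `h ∈ H_S` on the Borel model. [folklore] -/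
abbrev borelModelHecke (h : borelAwayFrom (n := 2) S) :
    Module.End E (borelModelCohomology S U ι hι ρ q) :=
  TwistedQuotient.heckeEnd (ι.codRestrict _ hι) (U.subgroupOf (borelAwayFrom S)) ρ h q

/-- Restriction `H^q(Γ, Fun(𝒢 ⧸ U, V)) → H^q(Γ, Fun(H_S ⧸ (U ∩ H_S), V))`. [folklore] -/
abbrev borelModelRes : TwistedQuotient.cohomology ι U ρ q →ₗ[E] borelModelCohomology S U ι hι ρ q :=
  (TwistedQuotient.subgroupRestrictMap ι U ρ (borelAwayFrom S) hι q).hom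

variable {S U}
variable (hS : S.Finite)
  (hU : ∀ w, w ∉ S → ArithmeticQuotient.IsUnramifiedLevel
    (valuedCongruenceSubgroup (Fin 2) (1 : WithZero (Multiplicative ℤ)))
    (ofLocal 2 K w) (localComponent 2 K w) U)
  (hHU : ∀ g : FiniteAdelicGL 2 K, ∃ h : borelAwayFrom (n := 2) S, ∃ u ∈ U,
    g = (h : FiniteAdelicGL 2 K) * u)
  [IsAlgClosed E] [CharZero E] [FiniteDimensional E (borelModelCohomology S U ι hι ρ q)]

include hS hU hHU

/-- **Hecke eigenvalues on the Borel stratum factor.**  See the module docstring.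
[cite: Harder1987, §2] -/
theorem exists_eigenvalue_factorisation
    {x : TwistedQuotient.cohomology ι U ρ q} (hx : x ≠ 0) (a : HeightOneSpectrum (𝓞 K) → ℕ → E)
    (ha : ∀ᶠ w in Filter.cofinite,
      TwistedQuotient.heckeEnd ι U ρ (heckeElement 2 K w 1) q x = a w 1 • x ∧
        TwistedQuotient.heckeEnd ι U ρ (heckeElement 2 K w 2) q x = a w 2 • x) :
    ∃ (y₀ : borelModelCohomology S U ι hι ρ q) (μ ζ : HeightOneSpectrum (𝓞 K) → E), y₀ ≠ 0 ∧
      (∀ w, w ∉ S →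
        borelModelHecke S U ι hι ρ q (borelHeckeElement₂ S w) y₀ = μ w • y₀ ∧
        borelModelHecke S U ι hι ρ q (borelCentralElement S w) y₀ = ζ w • y₀ ∧ μ w ≠ 0) ∧
      ∀ᶠ w in Filter.cofinite,
        a w 1 = (Ideal.absNorm w.asIdeal : E) * ζ w * (μ w)⁻¹ + μ w ∧ a w 2 = ζ w := by
  classical
  -- push–pull
  have hYX : ∀ w : {w // w ∉ S},
      borelModelHecke S U ι hι ρ q ((borelHeckeElement₂ S w.1)⁻¹) ∘ₗ
          borelModelHecke S U ι hι ρ q (borelHeckeElement₂ S w.1) =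
        (Ideal.absNorm w.1.asIdeal : E) • LinearMap.id := fun w => LinearMap.ext fun y => by
    rw [LinearMap.comp_apply, LinearMap.smul_apply, LinearMap.id_apply, borelModelHecke,
      borelModelHecke, heckeEnd_borelHeckeElement₂_inv_heckeEnd w.2 (hU w.1 w.2) ι hι ρ q y,
      Nat.cast_smul_eq_nsmul]
  have hN : ∀ w : {w // w ∉ S}, (Ideal.absNorm w.1.asIdeal : E) ≠ 0 := fun w => by
    rw [Nat.cast_ne_zero, Ne, Ideal.absNorm_eq_zero_iff]
    exact w.1.ne_bot
  -- commutation
  have hXX : ∀ (w w' : {w // w ∉ S}) (v : borelModelCohomology S U ι hι ρ q),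
      borelModelHecke S U ι hι ρ q (borelHeckeElement₂ S w.1)
          (borelModelHecke S U ι hι ρ q (borelHeckeElement₂ S w'.1) v) =
        borelModelHecke S U ι hι ρ q (borelHeckeElement₂ S w'.1)
          (borelModelHecke S U ι hι ρ q (borelHeckeElement₂ S w.1) v) := by
    intro w w' v
    by_cases hww : w = w'
    · rw [hww]
    · have hne : w'.1 ≠ w.1 := fun h => hww (Subtype.ext h.symm)
      exact TwistedQuotient.heckeEnd_comm_of_orthogonal _ _ ρ
        (isUnramifiedLevel_borelAwayFrom (n := 2) w.2 (hU w.1 w.2))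
        (isUnramifiedLevel_borelAwayFrom (n := 2) w'.2 (hU w'.1 w'.2))
        (fun y => toBorelLocal_ofBorelLocal_of_ne w'.2 hne y) _ _ q v
  have hXZ : ∀ (w w' : {w // w ∉ S}) (v : borelModelCohomology S U ι hι ρ q),
      borelModelHecke S U ι hι ρ q (borelHeckeElement₂ S w.1)
          (borelModelHecke S U ι hι ρ q (borelCentralElement S w'.1) v) =
        borelModelHecke S U ι hι ρ q (borelCentralElement S w'.1)
          (borelModelHecke S U ι hι ρ q (borelHeckeElement₂ S w.1) v) := fun w w' v =>
    TwistedQuotient.heckeEnd_comm_central _ _ ρ borelCentralElement_mem_center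
      (finite_doubleCosetQuot_borelHeckeElement w.2 (hU w.1 w.2) false) q v
  have hZZ : ∀ (w w' : {w // w ∉ S}) (v : borelModelCohomology S U ι hι ρ q),
      borelModelHecke S U ι hι ρ q (borelCentralElement S w.1)
          (borelModelHecke S U ι hι ρ q (borelCentralElement S w'.1) v) =
        borelModelHecke S U ι hι ρ q (borelCentralElement S w'.1)
          (borelModelHecke S U ι hι ρ q (borelCentralElement S w.1) v) := fun w w' v =>
    TwistedQuotient.heckeEnd_comm_of_mem_center _ _ ρ borelCentralElement_mem_center
      borelCentralElement_mem_center q v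
  -- the restricted class and its eigen-equations
  have hy0 : borelModelRes S U ι hι ρ q x ≠ 0 := fun h =>
    hx (TwistedQuotient.subgroupRestrictMap_injective ι U ρ _ hι hHU q
      (h.trans (map_zero (borelModelRes S U ι hι ρ q)).symm))
  have hev : ∀ᶠ w : {w // w ∉ S} in Filter.comap Subtype.val Filter.cofinite,
      (borelModelHecke S U ι hι ρ q (borelCentralElement S w.1) ∘ₗ
            borelModelHecke S U ι hι ρ q ((borelHeckeElement₂ S w.1)⁻¹) +
          borelModelHecke S U ι hι ρ q (borelHeckeElement₂ S w.1)) (borelModelRes S U ι hι ρ q x) =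
        a w.1 1 • borelModelRes S U ι hι ρ q x ∧
      borelModelHecke S U ι hι ρ q (borelCentralElement S w.1) (borelModelRes S U ι hι ρ q x) =
        a w.1 2 • borelModelRes S U ι hι ρ q x := by
    rw [Filter.eventually_comap]
    filter_upwards [ha] with v hv
    rintro ⟨w, hw⟩ rfl
    obtain ⟨h1, h2⟩ := hv
    have hUw := hU w hw
    constructor
    · have h1' := congrArg (borelModelRes S U ι hι ρ q) h1
      rw [map_smul, borelModelRes, subgroupRestrictMap_heckeEnd_heckeElement_one hw hUw ι hι ρ q x,
        heckeEnd_borelHeckeElement₁_eq hw hUw ι hι ρ q,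
        TwistedQuotient.heckeEnd_comm_central _ _ ρ borelCentralElement_mem_center
          (finite_doubleCosetQuot_borelHeckeElement₂_inv hw hUw) q] at h1'
      rw [LinearMap.add_apply, LinearMap.comp_apply]
      exact h1'
    · have h2' := congrArg (borelModelRes S U ι hι ρ q) h2
      rw [map_smul, borelModelRes, subgroupRestrictMap_heckeEnd_heckeElement_two ι hι ρ q x] at h2'
      exact h2'
  -- linear algebra
  obtain ⟨y₀, μ', ζ', hy₀, hμ', hζ', hμ'0, hev'⟩ :=
    exists_pushPull_eigenvalues (Filter.comap Subtype.val Filter.cofinite)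
      (fun w : {w // w ∉ S} => borelModelHecke S U ι hι ρ q (borelHeckeElement₂ S w.1))
      (fun w => borelModelHecke S U ι hι ρ q ((borelHeckeElement₂ S w.1)⁻¹))
      (fun w => borelModelHecke S U ι hι ρ q (borelCentralElement S w.1))
      (fun w => (Ideal.absNorm w.1.asIdeal : E)) hYX hN hXX hXZ hZZ hy0 (fun w => a w.1 1)
      (fun w => a w.1 2) hev
  refine ⟨y₀, fun w => if hw : w ∉ S then μ' ⟨w, hw⟩ else 1,
    fun w => if hw : w ∉ S then ζ' ⟨w, hw⟩ else 1, hy₀, fun w hw => ?_, ?_⟩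
  · simp only [hw, not_false_eq_true, dif_pos]
    exact ⟨hμ' ⟨w, hw⟩, hζ' ⟨w, hw⟩, hμ'0 ⟨w, hw⟩⟩
  · -- back to the cofinite filter on all places
    rw [Filter.eventually_comap] at hev'
    have hSc : ∀ᶠ w in Filter.cofinite, w ∉ S := by
      rw [Filter.eventually_cofinite]
      exact hS.subset fun w hw => not_not.1 hw
    filter_upwards [hev', hSc] with w hw hwS
    obtain ⟨h1, h2⟩ := hw ⟨w, hwS⟩ rfl
    simp only [hwS, not_false_eq_true, dif_pos]
    exact ⟨h1, h2⟩

end Factorisation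

end BigHeckeGLn

end Literature.NumberTheory.Automorphic
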